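import Summits.ResolutionOfSingularities.ResolutionOfSingularities.Theorems.FrobeniusClosingSteerCompletionRecognition
import HarnessLib

/-!
# Crux `Steer` (stmt-ResolutionOfSingularities-16345), chain W4.1, K3ᴳ / ℓ-COMPARISON last mile, piece (a): the COMPLETED map of a local homomorphism

OURS (campaign `res-hironaka`, rung L ★L-G4, slot W4.1; seat res-L0-w41-stub-2 g6; `K3G/JacobianLengthEtale-PLAN.md` §v1.4 (a)). Theses-free,
definition-free. A ring map `φ : S → T` of Noetherian local rings with `𝔪_S T ⊆ 𝔪_T` extends to a LOCAL homomorphism `ψ : Ŝ → T̂` of the adic completions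
over `φ` (`Isol.exists_ringHom_adicCompletion_extend` + `IsLocalRing.local_hom_TFAE`) — the input `(ψ, hψ, IsLocalHom ψ)` of
`JacobianLength.length_quotient_span_derivation_le_of_completed` (p569745). [folklore]

* `CompletedMap.exists_completed_localHom`.
-/

noncomputable section

set_option linter.dupNamespace false

open IsLocalRing

namespace Summit.ResolutionOfSingularities.ResolutionOfSingularities.Theorems.SwitchingDichotomy.CompletedMap

/-- **The completed map of a local homomorphism is a local homomorphism `Ŝ → T̂` over it.** [folklore] -/
theorem exists_completed_localHom {S T : Type} [CommRing S] [CommRing T] [IsLocalRing S] [IsNoetherianRing S] [IsLocalRing T] [IsNoetherianRing T]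
    (φ : S →+* T) (hφ : (maximalIdeal S).map φ ≤ maximalIdeal T) :
    ∃ ψ : AdicCompletion (maximalIdeal S) S →+* AdicCompletion (maximalIdeal T) T,
      (∀ s, ψ (algebraMap S _ s) = algebraMap T _ (φ s)) ∧ IsLocalHom ψ := by
  have hg : (maximalIdeal S).map ((algebraMap T (AdicCompletion (maximalIdeal T) T)).comp φ) ≤ maximalIdeal (AdicCompletion (maximalIdeal T) T) := by
    rw [← Ideal.map_map, AdicCompletion.maximalIdeal_eq_map]
    exact Ideal.map_mono hφ
  obtain ⟨ψ, hψ⟩ := Isol.exists_ringHom_adicCompletion_extend (maximalIdeal S) (maximalIdeal (AdicCompletion (maximalIdeal T) T))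
    ((algebraMap T (AdicCompletion (maximalIdeal T) T)).comp φ) hg
  have hψ_of : ∀ s : S, ψ (algebraMap S _ s) = algebraMap T _ (φ s) := fun s => by
    rw [AdicCompletion.algebraMap_apply, Algebra.algebraMap_self_apply]; exact hψ s
  have hψloc : (maximalIdeal (AdicCompletion (maximalIdeal S) S)).map ψ ≤ maximalIdeal (AdicCompletion (maximalIdeal T) T) := by
    have hcomp : ψ.comp (algebraMap S (AdicCompletion (maximalIdeal S) S)) = (algebraMap T (AdicCompletion (maximalIdeal T) T)).comp φ :=
      RingHom.ext hψ_of
    rw [AdicCompletion.maximalIdeal_eq_map, Ideal.map_map, hcomp]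
    exact hg
  exact ⟨ψ, hψ_of, ((local_hom_TFAE ψ).out 2 0).mp hψloc⟩

end Summit.ResolutionOfSingularities.ResolutionOfSingularities.Theorems.SwitchingDichotomy.CompletedMap

end
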